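import Mathlib
import HarnessLib
import Literature.AlgebraicGeometry.Resolution.CobordantBlowupFiltration

/-!
# S1a — (T2b) gr-TRIVIALITY: a depth-weighted centre makes `σ` raise the weight of every element

[OURS · L1 W4.5c · lead-1 g6, after plan-1 g11's SIG `L/w45c/W45cT2Signatures.lean` f384756d9d5bd870 (T2b)] — NOT a
statement of the manuscript; counted 0; AI-level work, weaker than expert review. Crux stmt-ResolutionOfSingularities-17941,
line `s1a-logminvertex` v6, stub `stub_winningStrategy` ((R0) one-shot branch).

Over the treeʼs weighted filtration `K n = (weightedFiltration f w).ideal n` (Włodarczyk Lemma 2.1.9; monomials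
`∏ f i ^ a i` of weight `∑ a i w i ≥ n`): **`grTriviality`** — if `σ b − b ∈ K 1` for every `b` (the centre contains the
fixed locus) and `σ (f i) − f i ∈ K (w i + 1)` for every `i` (the weights are DEPTHS), then `σ y − y ∈ K (n + 1)` for
every `y ∈ K n`: `σ` acts trivially on `gr_K B`. (Telescoping `σ (a b) − a b = σ a (σ b − b) + (σ a − a) b` along
monomials, then `K`-linearity via `σ (c y) − c y = σ c (σ y − y) + (σ c − c) y`.) This is hypothesis (3) of the
abstract one-shot kill lemma (T2a, `…S1aOneShotKill`) read in the Rees/Kummer chart rings.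
-/

set_option linter.dupNamespace false

noncomputable section

open Literature.AlgebraicGeometry.Resolution

namespace Summit.ResolutionOfSingularities.ResolutionOfSingularities.Theorems.WildQuotientResolution.S1.OneShotKill

universe u v

variable {B : Type u} [CommRing B] (σ : B ≃+* B) {ι : Type v} (f : ι → B) (w : ι → ℕ)

/-- The predicate «`m` has weight `≥ n` and `σ` raises it»; it is multiplicative. -/
theorem raises_mul {a b : B} {m n : ℕ}
    (ha : a ∈ (weightedFiltration f w).ideal m ∧ σ a - a ∈ (weightedFiltration f w).ideal (m + 1))
    (hb : b ∈ (weightedFiltration f w).ideal n ∧ σ b - b ∈ (weightedFiltration f w).ideal (n + 1)) :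
    a * b ∈ (weightedFiltration f w).ideal (m + n) ∧ σ (a * b) - a * b ∈ (weightedFiltration f w).ideal (m + n + 1) := by
  refine ⟨(weightedFiltration f w).mul_le m n (Ideal.mul_mem_mul ha.1 hb.1), ?_⟩
  have hσa : σ a ∈ (weightedFiltration f w).ideal m := by
    have : σ a = a + (σ a - a) := by ring
    rw [this]
    exact Ideal.add_mem _ ha.1 ((weightedFiltration f w).antitone (Nat.le_succ m) ha.2)
  have key : σ (a * b) - a * b = σ a * (σ b - b) + (σ a - a) * b := by rw [map_mul]; ring
  rw [key]
  refine Ideal.add_mem _ ?_ ?_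
  · have := (weightedFiltration f w).mul_le m (n + 1) (Ideal.mul_mem_mul hσa hb.2)
    rwa [← add_assoc] at this
  · have := (weightedFiltration f w).mul_le (m + 1) n (Ideal.mul_mem_mul ha.2 hb.1)
    rwa [add_right_comm] at this

/-- `1` has weight `≥ 0` and is fixed. -/
theorem raises_one : (1 : B) ∈ (weightedFiltration f w).ideal 0 ∧ σ 1 - 1 ∈ (weightedFiltration f w).ideal (0 + 1) := by
  refine ⟨by rw [(weightedFiltration f w).ideal_zero]; trivial, ?_⟩
  rw [map_one, sub_self]; exact Ideal.zero_mem _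

/-- Powers of a centre generator. -/
theorem raises_pow (hf : ∀ i, σ (f i) - f i ∈ (weightedFiltration f w).ideal (w i + 1)) (i : ι) :
    ∀ k : ℕ, f i ^ k ∈ (weightedFiltration f w).ideal (k * w i) ∧
      σ (f i ^ k) - f i ^ k ∈ (weightedFiltration f w).ideal (k * w i + 1)
  | 0 => by rw [pow_zero, zero_mul]; exact raises_one σ f w
  | k + 1 => by
    have h := raises_mul σ f w (raises_pow hf i k) ⟨mem_weightedFiltration_ideal f w i, hf i⟩
    rw [← pow_succ] at h
    have e : k * w i + w i = (k + 1) * w i := by ring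
    rw [e] at h
    exact h

/-- Monomials in the centre generators. -/
theorem raises_prod (hf : ∀ i, σ (f i) - f i ∈ (weightedFiltration f w).ideal (w i + 1)) (a : ι → ℕ)
    (s : Finset ι) :
    (∏ i ∈ s, f i ^ a i) ∈ (weightedFiltration f w).ideal (∑ i ∈ s, a i * w i) ∧
      σ (∏ i ∈ s, f i ^ a i) - ∏ i ∈ s, f i ^ a i ∈ (weightedFiltration f w).ideal (∑ i ∈ s, a i * w i + 1) := by
  classical
  induction s using Finset.induction_on with
  | empty => rw [Finset.prod_empty, Finset.sum_empty]; exact raises_one σ f w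
  | insert j s hj ih =>
    rw [Finset.prod_insert hj, Finset.sum_insert hj]
    exact raises_mul σ f w (raises_pow σ f w hf j (a j)) ih

/-- The weighted monomials of weight `≥ n` are raised into `K (n + 1)`. -/
theorem raises_of_mem_weightedMonomials (hf : ∀ i, σ (f i) - f i ∈ (weightedFiltration f w).ideal (w i + 1))
    {n : ℕ} {m : B} (hm : m ∈ weightedMonomials f w n) :
    σ m - m ∈ (weightedFiltration f w).ideal (n + 1) := by
  classical
  obtain ⟨α, hα, rfl⟩ := hm
  have h := (raises_prod σ f w hf α α.support).2
  have hwt : ∑ i ∈ α.support, α i * w i = Finsupp.weight w α := by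
    rw [Finsupp.weight_apply, Finsupp.sum]; simp only [smul_eq_mul]
  rw [Finsupp.prod, ← Finset.prod_congr rfl fun i _ => rfl]
  rw [hwt] at h
  exact (weightedFiltration f w).antitone (Nat.succ_le_succ hα) h

/-- **(T2b) gr-TRIVIALITY.** [OURS · L1 W4.5c] -/
theorem grTriviality (h1 : ∀ b : B, σ b - b ∈ (weightedFiltration f w).ideal 1)
    (hf : ∀ i, σ (f i) - f i ∈ (weightedFiltration f w).ideal (w i + 1)) (n : ℕ) (y : B)
    (hy : y ∈ (weightedFiltration f w).ideal n) : σ y - y ∈ (weightedFiltration f w).ideal (n + 1) := by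
  rw [weightedFiltration_ideal] at hy
  induction hy using Submodule.span_induction with
  | mem m hm => exact raises_of_mem_weightedMonomials σ f w hf hm
  | zero => rw [map_zero, sub_self]; exact Ideal.zero_mem _
  | add x z hx hz ihx ihz =>
    have : σ (x + z) - (x + z) = (σ x - x) + (σ z - z) := by rw [map_add]; ring
    rw [this]; exact Ideal.add_mem _ ihx ihz
  | smul c x hx ihx =>
    have hx' : x ∈ (weightedFiltration f w).ideal n := by rw [weightedFiltration_ideal]; exact hx
    have : σ (c • x) - c • x = σ c * (σ x - x) + (σ c - c) * x := by rw [smul_eq_mul, map_mul]; ring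
    rw [this]
    refine Ideal.add_mem _ (Ideal.mul_mem_left _ _ ihx) ?_
    have := (weightedFiltration f w).mul_le 1 n (Ideal.mul_mem_mul (h1 c) hx')
    rwa [add_comm] at this

/-- Corollary: `σ` preserves every piece of the weighted filtration (σ-adaptedness from depth). -/
theorem map_weightedFiltration_le (h1 : ∀ b : B, σ b - b ∈ (weightedFiltration f w).ideal 1)
    (hf : ∀ i, σ (f i) - f i ∈ (weightedFiltration f w).ideal (w i + 1)) (n : ℕ) :
    ((weightedFiltration f w).ideal n).map (σ : B →+* B) ≤ (weightedFiltration f w).ideal n := by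
  rw [Ideal.map_le_iff_le_comap]
  intro y hy
  rw [Ideal.mem_comap, RingHom.coe_coe]
  have : σ y = y + (σ y - y) := by ring
  rw [this]
  exact Ideal.add_mem _ hy ((weightedFiltration f w).antitone (Nat.le_succ n) (grTriviality σ f w h1 hf n y hy))

end Summit.ResolutionOfSingularities.ResolutionOfSingularities.Theorems.WildQuotientResolution.S1.OneShotKill

end
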